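import Summits.QuantumFields.YangMills.Theorems.VirialFluxGapTauberWeights
import Summits.QuantumFields.YangMills.Theorems.VirialFluxGapLaplaceLayerCake
import HarnessLib

/-!
# Route `VirialFluxGap` (YangMills): preparatory estimates for the Tauberian mean bound (`stub_tauberMeanUpper`, crux 24141)

Fourth helper file toward stub `stub_tauberMeanUpper` of LINE «tauber-mean» (planner ym-idea-4 g14) on the deciding crux
`VirialFluxGap.PeriodicSoftness` (stmt-QuantumFields-24141).  Mathlib only:

* the slowly varying factor `ℓ(s) = e·log s⁻¹ + c` (`e ≥ 0`): antitone on `(0,∞)`, and `|ℓ(s)| ≤ e·s⁻¹ + (e|log t₀| + |c|)` on `(0, t₀]`;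
* the DOMINATING WEIGHT `K(s) = β e^{−βs} s^{ρ−1} (1+s)³` is integrable on `(0,∞)` for `ρ > 0` (so every product
  `g·(βs ± A)·s^θ·ℓ·𝟙_{≤t₀}` met in the Chebyshev step is integrable by domination);
* the quadratic tail `∫_{s>t} β²s e^{−βs} ds = (βt+1)e^{−βt}`;
* the THRESHOLD ARITHMETIC: under `64(ρ+2)²(1 + |log v| + |log ℓ₀| + |log t₀| + log β) ≤ βt₀` (`β ≥ 2`, `ρ ≥ 1`),
  `(βt₀+1)e^{−βt₀} ≤ (3/2)·v·ℓ₀·e^{−2}·β^{−(ρ+1)}` (`tail_le_floor`);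
* the pointwise DOMINATION of the weighted integrands `g·(q·h)` (`g = βe^{−βs}s^ρ`, `|q| ≤ Q(1+s)²`, `|h| ≤ e/s + C₁`) by multiples of `K`,
  the bounds `|βs − A|, |(βs+A)s^θ| ≤ (β+A)(1+s)²`, and the BRACKET ARITHMETIC `−E + t(ρ+2+A) ≤ −3/(2β)` (`t = κu ≤ 1/4`).

HONEST FRAMING: generic real analysis; no stub / crux / rung / summit is closed by this file; the Yang–Mills mass gap is NOT proved.  THEOREMS ONLY
(0 `def`, 0 `sorry`), standard axioms.  References: [cite: Griffiths1964]; [cite: TomboulisYaffe1985].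
-/

set_option autoImplicit false

noncomputable section

open MeasureTheory Set Filter Real
open scoped Topology
open Summit.QuantumFields.YangMills.Theorems.VirialFluxGap.ChebyshevGamma
open Summit.QuantumFields.YangMills.Theorems.VirialFluxGap.TauberWeights
open Summit.QuantumFields.YangMills.Theorems.VirialFluxGap.LaplaceLayerCake

namespace Summit.QuantumFields.YangMills.Theorems.VirialFluxGap.TauberMeanUpperPrep

/-! ## §1 The slowly varying factor -/

/-- `ℓ(s) = e log s⁻¹ + c` is antitone on `(0,∞)` when `e ≥ 0`. [folklore] -/
theorem ell_antitoneOn {e c : ℝ} (he : 0 ≤ e) :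
    AntitoneOn (fun s : ℝ => e * Real.log s⁻¹ + c) (Ioi 0) := by
  intro x hx y _ hxy
  have hx0 : (0 : ℝ) < x := hx
  have h1 : Real.log y⁻¹ ≤ Real.log x⁻¹ := by
    rw [Real.log_inv, Real.log_inv, neg_le_neg_iff]
    exact Real.log_le_log hx0 hxy
  have := mul_le_mul_of_nonneg_left h1 he
  simp only
  linarith

/-- On `(0, t₀]`: `|e log s⁻¹ + c| ≤ e·s⁻¹ + (e·|log t₀| + |c|)` (`e ≥ 0`). [folklore] -/
theorem abs_ell_le {e c t₀ s : ℝ} (he : 0 ≤ e) (hs : 0 < s) (hst : s ≤ t₀) :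
    |e * Real.log s⁻¹ + c| ≤ e * s⁻¹ + (e * |Real.log t₀| + |c|) := by
  have hlog_up : Real.log s ≤ |Real.log t₀| := (Real.log_le_log hs hst).trans (le_abs_self _)
  have hlog_lo : -s⁻¹ ≤ Real.log s := by
    have h := Real.log_le_sub_one_of_pos (inv_pos.mpr hs)
    rw [Real.log_inv] at h
    have : (0 : ℝ) < s⁻¹ := inv_pos.mpr hs
    linarith
  have habs : |Real.log s| ≤ s⁻¹ + |Real.log t₀| := by
    rw [abs_le]; constructor <;> linarith [abs_nonneg (Real.log t₀), inv_pos.mpr hs]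
  calc |e * Real.log s⁻¹ + c| ≤ |e * Real.log s⁻¹| + |c| := abs_add_le _ _
    _ = e * |Real.log s| + |c| := by rw [abs_mul, abs_of_nonneg he, Real.log_inv, abs_neg]
    _ ≤ e * (s⁻¹ + |Real.log t₀|) + |c| := by
        have := mul_le_mul_of_nonneg_left habs he; linarith
    _ = e * s⁻¹ + (e * |Real.log t₀| + |c|) := by ring

/-! ## §2 The dominating weight `K(s) = β e^{−βs} s^{ρ−1} (1+s)³` -/

/-- `K` is integrable on `(0,∞)` for `ρ > 0`, `β > 0`. [folklore] -/
theorem integrableOn_K {β ρ : ℝ} (hβ : 0 < β) (hρ : 0 < ρ) :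
    IntegrableOn (fun s : ℝ => β * Real.exp (-(β * s)) * s ^ (ρ - 1) * (1 + s) ^ 3) (Ioi 0) := by
  have h0 := integrableOn_weight hβ (a := ρ - 1) (by linarith)
  have h1 := integrableOn_weight hβ (a := ρ - 1 + 1) (by linarith)
  have h2 := integrableOn_weight hβ (a := ρ - 1 + 2) (by linarith)
  have h3 := integrableOn_weight hβ (a := ρ - 1 + 3) (by linarith)
  have h : IntegrableOn (fun s : ℝ => β * Real.exp (-(β * s)) * s ^ (ρ - 1) +
      3 * (β * Real.exp (-(β * s)) * s ^ (ρ - 1 + 1)) + 3 * (β * Real.exp (-(β * s)) * s ^ (ρ - 1 + 2)) +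
      β * Real.exp (-(β * s)) * s ^ (ρ - 1 + 3)) (Ioi 0) :=
    ((h0.add (h1.const_mul 3)).add (h2.const_mul 3)).add h3
  refine h.congr_fun (fun s hs => ?_) measurableSet_Ioi
  have hs' : (0 : ℝ) < s := hs
  have h2 : s ^ (2 : ℝ) = s ^ 2 := Real.rpow_two s
  have h3 : s ^ (3 : ℝ) = s ^ 3 := by exact_mod_cast Real.rpow_natCast s 3
  dsimp only
  rw [Real.rpow_add hs' (ρ - 1) 1, Real.rpow_add hs' (ρ - 1) 2, Real.rpow_add hs' (ρ - 1) 3, Real.rpow_one, h2, h3]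
  ring

/-- Domination by `C·K` gives integrability on `(0,∞)`. [folklore] -/
theorem integrableOn_of_le_K {β ρ C : ℝ} (hβ : 0 < β) (hρ : 0 < ρ) {ψ : ℝ → ℝ} (hψ : Measurable ψ)
    (hle : ∀ s ∈ Ioi (0 : ℝ), |ψ s| ≤ C * (β * Real.exp (-(β * s)) * s ^ (ρ - 1) * (1 + s) ^ 3)) :
    IntegrableOn ψ (Ioi 0) := by
  refine Integrable.mono' ((integrableOn_K hβ hρ).const_mul C) hψ.aestronglyMeasurable ?_
  filter_upwards [ae_restrict_mem measurableSet_Ioi] with s hs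
  rw [Real.norm_eq_abs]
  exact hle s hs

/-- The basic weight `g(s) = β e^{−βs} s^ρ` times `(1+s)^k`, `k ≤ 3`, is below `K`: `g·(1+s)² ·s ≤ … ` — precisely
`β e^{−βs} s^ρ (1+s)^2 ≤ K(s)` for `s > 0`. [folklore] -/
theorem weight_mul_sq_le_K {β ρ s : ℝ} (hβ : 0 < β) (hs : 0 < s) :
    β * Real.exp (-(β * s)) * s ^ ρ * (1 + s) ^ 2 ≤ β * Real.exp (-(β * s)) * s ^ (ρ - 1) * (1 + s) ^ 3 := by
  have h1 : s ^ ρ = s ^ (ρ - 1) * s := by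
    rw [Real.rpow_sub_one hs.ne']; field_simp
  rw [h1]
  have hw : 0 ≤ β * Real.exp (-(β * s)) * s ^ (ρ - 1) := by
    have := Real.rpow_nonneg hs.le (ρ - 1); positivity
  have hpoly : s * (1 + s) ^ 2 ≤ (1 + s) ^ 3 := by nlinarith
  calc β * Real.exp (-(β * s)) * (s ^ (ρ - 1) * s) * (1 + s) ^ 2
      = (β * Real.exp (-(β * s)) * s ^ (ρ - 1)) * (s * (1 + s) ^ 2) := by ring
    _ ≤ (β * Real.exp (-(β * s)) * s ^ (ρ - 1)) * (1 + s) ^ 3 := mul_le_mul_of_nonneg_left hpoly hw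
    _ = β * Real.exp (-(β * s)) * s ^ (ρ - 1) * (1 + s) ^ 3 := by ring

/-! ## §3 The quadratic exponential tail -/

/-- `∫_{s>t} β·(βs)·e^{−βs} ds = (βt + 1) e^{−βt}` for `t ≥ 0`. [folklore] -/
theorem integral_Ioi_sq_mul_exp {β t : ℝ} (hβ : 0 < β) (ht : 0 ≤ t) :
    ∫ s in Ioi t, β * (β * s) * Real.exp (-(β * s)) = (β * t + 1) * Real.exp (-(β * t)) := by
  have h1 := integral_Ioi_sub_one_mul_exp_neg_mul hβ ht
  have h2 := integral_Ioi_const_mul_exp_neg_mul hβ t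
  -- integrability of the two pieces on `(t, ∞)`
  have hI0 : IntegrableOn (fun s : ℝ => β * Real.exp (-(β * s))) (Ioi t) := by
    have h : IntegrableOn (fun s : ℝ => β * Real.exp (-β * s)) (Ioi t) := (exp_neg_integrableOn_Ioi t hβ).const_mul β
    exact h.congr_fun (fun s _ => by simp only [neg_mul]) measurableSet_Ioi
  have hI1 : IntegrableOn (fun s : ℝ => (β * s - 1) * Real.exp (-(β * s))) (Ioi t) := by
    have h1' : IntegrableOn (fun s : ℝ => s ^ (1 : ℝ) * Real.exp (-β * s ^ (1 : ℝ))) (Ioi 0) :=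
      integrableOn_rpow_mul_exp_neg_mul_rpow (by norm_num) le_rfl hβ
    have h0' : IntegrableOn (fun s : ℝ => s ^ (0 : ℝ) * Real.exp (-β * s ^ (1 : ℝ))) (Ioi 0) :=
      integrableOn_rpow_mul_exp_neg_mul_rpow (by norm_num) le_rfl hβ
    have ha : IntegrableOn (fun s : ℝ => s * Real.exp (-(β * s))) (Ioi 0) :=
      h1'.congr_fun (fun s _ => by simp only [Real.rpow_one, neg_mul]) measurableSet_Ioi
    have hb : IntegrableOn (fun s : ℝ => Real.exp (-(β * s))) (Ioi 0) :=
      h0'.congr_fun (fun s _ => by simp only [Real.rpow_zero, Real.rpow_one, one_mul, neg_mul]) measurableSet_Ioi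
    have h : IntegrableOn (fun s : ℝ => β * (s * Real.exp (-(β * s))) - Real.exp (-(β * s))) (Ioi 0) :=
      (ha.const_mul β).sub hb
    exact (h.mono_set (Ioi_subset_Ioi ht)).congr_fun (fun s _ => by ring) measurableSet_Ioi
  have hpt : ∀ s : ℝ, β * (β * s) * Real.exp (-(β * s)) = β * ((β * s - 1) * Real.exp (-(β * s))) + β * Real.exp (-(β * s)) :=
    fun s => by ring
  simp_rw [hpt]
  rw [integral_add (hI1.const_mul β) hI0, integral_const_mul, h1, h2]
  ring

/-! ## §4 Threshold arithmetic -/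

/-- ★ Under the «tauber-mean» threshold `64(ρ+2)²(1 + |log v| + |log ℓ₀| + |log t₀| + log β) ≤ βt₀` (`β ≥ 2`, `ρ ≥ 1`, `v, ℓ₀ > 0`):
`(βt₀ + 1)·e^{−βt₀} ≤ (3/2)·v·ℓ₀·e^{−2}·β^{−(ρ+1)}` and `2/β ≤ t₀`. [folklore] -/
theorem tail_le_floor {ρ v ℓ₀ t₀ β : ℝ} (hρ : 1 ≤ ρ) (hv : 0 < v) (hℓ₀ : 0 < ℓ₀) (ht₀ : 0 < t₀) (hβ : 2 ≤ β)
    (hX : 64 * (ρ + 2) ^ 2 * (1 + |Real.log v| + |Real.log ℓ₀| + |Real.log t₀| + Real.log β) ≤ β * t₀) :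
    (β * t₀ + 1) * Real.exp (-(β * t₀)) ≤ 3 / 2 * v * ℓ₀ * Real.exp (-2) * β ^ (-(ρ + 1)) ∧ 2 / β ≤ t₀ := by
  have hβ0 : 0 < β := by linarith
  have hlogβ : 0 < Real.log β := Real.log_pos (by linarith)
  set Y : ℝ := 1 + |Real.log v| + |Real.log ℓ₀| + |Real.log t₀| + Real.log β with hY
  have hY1 : 1 ≤ Y := by rw [hY]; have := abs_nonneg (Real.log v); have := abs_nonneg (Real.log ℓ₀);
                                  have := abs_nonneg (Real.log t₀); linarith
  set x : ℝ := β * t₀ with hx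
  have hρ2 : 9 ≤ (ρ + 2) ^ 2 := by nlinarith
  have hx1 : 64 * 9 * 1 ≤ x := by
    calc (64 : ℝ) * 9 * 1 ≤ 64 * (ρ + 2) ^ 2 * Y := by
          apply mul_le_mul (mul_le_mul_of_nonneg_left hρ2 (by norm_num)) hY1 (by norm_num) (by positivity)
      _ ≤ x := hX
  constructor
  · -- (i) `x + 1 ≤ 2 e^{x/2}`; (ii) `β^{ρ+1} ≤ e^{x/4}`; (iii) `(4e²/3)/(vℓ₀) ≤ e^{x/4}`
    have hi : x + 1 ≤ 2 * Real.exp (x / 2) := by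
      have := Real.add_one_le_exp (x / 2); linarith
    have hii : β ^ (ρ + 1) ≤ Real.exp (x / 4) := by
      rw [Real.rpow_def_of_pos hβ0]
      refine Real.exp_le_exp.2 ?_
      have h1 : Real.log β * (ρ + 1) ≤ Y * (16 * (ρ + 2) ^ 2) := by
        apply mul_le_mul _ _ (by linarith) (by linarith)
        · rw [hY]; have := abs_nonneg (Real.log v); have := abs_nonneg (Real.log ℓ₀);
                   have := abs_nonneg (Real.log t₀); linarith
        · nlinarith
      linarith
    have hiii : 4 * Real.exp 2 / 3 ≤ v * ℓ₀ * Real.exp (x / 4) := by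
      -- `log(4e²/3) ≤ 3 ≤ log v + log ℓ₀ + x/4`
      have hlog43 : Real.log (4 / 3) ≤ 1 := by
        have := Real.log_le_sub_one_of_pos (by norm_num : (0:ℝ) < 4 / 3); linarith
      have hlhs : 4 * Real.exp 2 / 3 = Real.exp (Real.log (4 / 3) + 2) := by
        rw [Real.exp_add, Real.exp_log (by norm_num)]; ring
      have hrhs : v * ℓ₀ * Real.exp (x / 4) = Real.exp (Real.log v + Real.log ℓ₀ + x / 4) := by
        rw [Real.exp_add, Real.exp_add, Real.exp_log hv, Real.exp_log hℓ₀]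
      rw [hlhs, hrhs]
      refine Real.exp_le_exp.2 ?_
      have h1 : -Real.log v ≤ |Real.log v| := neg_le_abs _
      have h2 : -Real.log ℓ₀ ≤ |Real.log ℓ₀| := neg_le_abs _
      have h3 : 3 * Y ≤ x / 4 := by
        have : 3 * Y ≤ 16 * (ρ + 2) ^ 2 * Y := by nlinarith
        linarith
      rw [hY] at h3
      have := abs_nonneg (Real.log t₀)
      linarith
    -- combine
    have hexp : Real.exp (-(β * t₀)) = (Real.exp x)⁻¹ := by rw [hx, Real.exp_neg]
    have hex : Real.exp x = Real.exp (x / 2) * Real.exp (x / 4) * Real.exp (x / 4) := by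
      rw [← Real.exp_add, ← Real.exp_add]; congr 1; ring
    have hβneg : β ^ (-(ρ + 1)) = (β ^ (ρ + 1))⁻¹ := Real.rpow_neg hβ0.le _
    rw [hexp, hβneg]
    have hE0 : 0 < Real.exp x := Real.exp_pos _
    have hB0 : 0 < β ^ (ρ + 1) := Real.rpow_pos_of_pos hβ0 _
    rw [show (β * t₀ + 1) * (Real.exp x)⁻¹ = (x + 1) / Real.exp x by rw [hx]; field_simp,
      show 3 / 2 * v * ℓ₀ * Real.exp (-2) * (β ^ (ρ + 1))⁻¹ = (3 / 2 * v * ℓ₀ * Real.exp (-2)) / β ^ (ρ + 1) by field_simp,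
      div_le_div_iff₀ hE0 hB0]
    -- `(x+1) β^{ρ+1} ≤ 2e^{x/2}·e^{x/4}` and `2 e^{x/2} e^{x/4} · 1 ≤ (3/2) v ℓ₀ e^{-2} e^{x}`
    have h4 : (x + 1) * β ^ (ρ + 1) ≤ 2 * Real.exp (x / 2) * Real.exp (x / 4) :=
      mul_le_mul hi hii hB0.le (by positivity)
    have h5 : 2 * Real.exp (x / 2) * Real.exp (x / 4) ≤ 3 / 2 * v * ℓ₀ * Real.exp (-2) * Real.exp x := by
      rw [hex]
      have he2 : Real.exp (-2) * Real.exp 2 = 1 := by rw [← Real.exp_add]; norm_num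
      have : 2 * Real.exp (x / 2) * Real.exp (x / 4) =
          (3 / 2 * Real.exp (-2)) * (4 * Real.exp 2 / 3) * (Real.exp (x / 2) * Real.exp (x / 4)) := by
        field_simp; nlinarith [he2]
      rw [this]
      have hpos : 0 ≤ (3 / 2 * Real.exp (-2)) * (Real.exp (x / 2) * Real.exp (x / 4)) := by positivity
      calc (3 / 2 * Real.exp (-2)) * (4 * Real.exp 2 / 3) * (Real.exp (x / 2) * Real.exp (x / 4))
          = (4 * Real.exp 2 / 3) * ((3 / 2 * Real.exp (-2)) * (Real.exp (x / 2) * Real.exp (x / 4))) := by ring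
        _ ≤ (v * ℓ₀ * Real.exp (x / 4)) * ((3 / 2 * Real.exp (-2)) * (Real.exp (x / 2) * Real.exp (x / 4))) :=
            mul_le_mul_of_nonneg_right hiii hpos
        _ = 3 / 2 * v * ℓ₀ * Real.exp (-2) * (Real.exp (x / 2) * Real.exp (x / 4) * Real.exp (x / 4)) := by ring
    exact h4.trans h5
  · rw [div_le_iff₀ hβ0, mul_comm]
    linarith

/-! ## §5 Domination of the weighted integrands by `K(s) = βe^{−βs}s^{ρ−1}(1+s)³`, and the bracket arithmetic -/

/-- Core domination: for `s > 0`, `|q| ≤ Q(1+s)²` and `|h| ≤ e s⁻¹ + C₁` imply `|g(s)·(q·h)| ≤ Q(e+C₁)·K(s)`. [folklore] -/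
theorem dom_core {β ρ e C₁ Q s q h : ℝ} (hβ : 0 < β) (hs : 0 < s) (he : 0 ≤ e) (hC₁ : 0 ≤ C₁) (hQ : 0 ≤ Q)
    (hq : |q| ≤ Q * (1 + s) ^ 2) (hh : |h| ≤ e * s⁻¹ + C₁) :
    |β * Real.exp (-(β * s)) * s ^ ρ * (q * h)| ≤ Q * (e + C₁) * (β * Real.exp (-(β * s)) * s ^ (ρ - 1) * (1 + s) ^ 3) := by
  have hw0 : 0 ≤ β * Real.exp (-(β * s)) * s ^ (ρ - 1) := by
    have := Real.rpow_nonneg hs.le (ρ - 1); positivity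
  have hsρ : s ^ ρ = s ^ (ρ - 1) * s := by rw [Real.rpow_sub_one hs.ne']; field_simp
  have hX0 : 0 ≤ β * Real.exp (-(β * s)) * s ^ ρ := by rw [hsρ, ← mul_assoc]; exact mul_nonneg hw0 hs.le
  -- `s · |h| ≤ e + C₁ s ≤ (e + C₁)(1+s)`
  have h1 : s * |h| ≤ (e + C₁) * (1 + s) := by
    have hC₁s : C₁ * s ≤ C₁ * (1 + s) := mul_le_mul_of_nonneg_left (by linarith) hC₁
    have hes : e ≤ e * (1 + s) := le_mul_of_one_le_right he (by linarith)
    calc s * |h| ≤ s * (e * s⁻¹ + C₁) := mul_le_mul_of_nonneg_left hh hs.le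
      _ = e + C₁ * s := by field_simp
      _ ≤ (e + C₁) * (1 + s) := by linarith
  have h2 : |q| * (s * |h|) ≤ (Q * (1 + s) ^ 2) * ((e + C₁) * (1 + s)) :=
    mul_le_mul hq h1 (mul_nonneg hs.le (abs_nonneg _)) (by positivity)
  calc |β * Real.exp (-(β * s)) * s ^ ρ * (q * h)|
      = β * Real.exp (-(β * s)) * s ^ ρ * (|q| * |h|) := by rw [abs_mul, abs_of_nonneg hX0, abs_mul]
    _ = (β * Real.exp (-(β * s)) * s ^ (ρ - 1)) * (|q| * (s * |h|)) := by rw [hsρ]; ring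
    _ ≤ (β * Real.exp (-(β * s)) * s ^ (ρ - 1)) * ((Q * (1 + s) ^ 2) * ((e + C₁) * (1 + s))) :=
        mul_le_mul_of_nonneg_left h2 hw0
    _ = Q * (e + C₁) * (β * Real.exp (-(β * s)) * s ^ (ρ - 1) * (1 + s) ^ 3) := by ring

/-- Domination without the cut-off factor: `|q| ≤ Q(1+s)²` implies `|g(s)·q| ≤ Q·K(s)` (`s > 0`; `hβ` only fixes the sign of the weight). [folklore] -/
theorem dom_core' {β ρ Q s q : ℝ} (hβ : 0 < β) (hs : 0 < s) (hq : |q| ≤ Q * (1 + s) ^ 2) :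
    |β * Real.exp (-(β * s)) * s ^ ρ * q| ≤ Q * (β * Real.exp (-(β * s)) * s ^ (ρ - 1) * (1 + s) ^ 3) := by
  have hw0 : 0 ≤ β * Real.exp (-(β * s)) * s ^ (ρ - 1) := by
    have := Real.rpow_nonneg hs.le (ρ - 1); positivity
  have hsρ : s ^ ρ = s ^ (ρ - 1) * s := by rw [Real.rpow_sub_one hs.ne']; field_simp
  have hX0 : 0 ≤ β * Real.exp (-(β * s)) * s ^ ρ := by rw [hsρ, ← mul_assoc]; exact mul_nonneg hw0 hs.le
  have h2 : s * |q| ≤ (1 + s) * (Q * (1 + s) ^ 2) := mul_le_mul (by linarith) hq (abs_nonneg _) (by linarith)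
  calc |β * Real.exp (-(β * s)) * s ^ ρ * q|
      = β * Real.exp (-(β * s)) * s ^ ρ * |q| := by rw [abs_mul, abs_of_nonneg hX0]
    _ = (β * Real.exp (-(β * s)) * s ^ (ρ - 1)) * (s * |q|) := by rw [hsρ]; ring
    _ ≤ (β * Real.exp (-(β * s)) * s ^ (ρ - 1)) * ((1 + s) * (Q * (1 + s) ^ 2)) := mul_le_mul_of_nonneg_left h2 hw0
    _ = Q * (β * Real.exp (-(β * s)) * s ^ (ρ - 1) * (1 + s) ^ 3) := by ring

/-- `|βs − A| ≤ (β + A)(1+s)²` and `|(βs + A)s^θ| ≤ (β + A)(1+s)²` for `s > 0`, `A ≥ 0`, `0 ≤ θ ≤ 1`. [folklore] -/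
theorem linear_abs_le {β A s θ : ℝ} (hβ : 0 < β) (hA : 0 ≤ A) (hs : 0 < s) (hθ0 : 0 ≤ θ) (hθ1 : θ ≤ 1) :
    |β * s - A| ≤ (β + A) * (1 + s) ^ 2 ∧ |(β * s + A) * s ^ θ| ≤ (β + A) * (1 + s) ^ 2 := by
  have h1 : β * s + A ≤ (β + A) * (1 + s) := by nlinarith
  have h1s : 1 ≤ 1 + s := by linarith
  constructor
  · calc |β * s - A| ≤ |β * s| + |A| := abs_sub _ _
      _ = β * s + A := by rw [abs_of_nonneg (by positivity), abs_of_nonneg hA]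
      _ ≤ (β + A) * (1 + s) := h1
      _ ≤ (β + A) * (1 + s) ^ 2 := by
          have : (1 + s) ≤ (1 + s) ^ 2 := by nlinarith
          exact mul_le_mul_of_nonneg_left this (by positivity)
  · rw [abs_of_nonneg (mul_nonneg (by positivity) (Real.rpow_nonneg hs.le _))]
    -- `s^θ ≤ 1 + s` (cf. `Literature.NumberTheory.Sieve.rpow_le_one_add`)
    have hsθ : s ^ θ ≤ 1 + s := by
      rcases le_or_gt s 1 with h | h
      · exact (Real.rpow_le_one hs.le h hθ0).trans (by linarith)
      · calc s ^ θ ≤ s ^ (1 : ℝ) := Real.rpow_le_rpow_of_exponent_le h.le hθ1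
          _ = s := Real.rpow_one s
          _ ≤ 1 + s := by linarith
    calc (β * s + A) * s ^ θ ≤ ((β + A) * (1 + s)) * (1 + s) :=
          mul_le_mul h1 hsθ (Real.rpow_nonneg hs.le _) (by positivity)
      _ = (β + A) * (1 + s) ^ 2 := by ring

/-- The final bracket arithmetic: with `t = κu ≤ 1/4`, `E = (4ρ+5)t + 2/β`, `A = 1 + ρ + E`:
`−E + t(ρ + 2 + A) ≤ −3/(2β)`. [folklore] -/
theorem bracket_le {ρ β t : ℝ} (hρ : 0 < ρ) (hβ : 0 < β) (ht0 : 0 ≤ t) (ht : t ≤ 1 / 4) :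
    -((4 * ρ + 5) * t + 2 / β) + t * (ρ + 2 + (1 + ρ + ((4 * ρ + 5) * t + 2 / β))) ≤ -(3 / (2 * β)) := by
  have hb : 0 < 1 / β := by positivity
  have h1 : (4 * ρ + 5) * t * t ≤ (4 * ρ + 5) * t * (1 / 4) := mul_le_mul_of_nonneg_left ht (by positivity)
  have h2 : t * (2 / β) ≤ 1 / 4 * (2 / β) := mul_le_mul_of_nonneg_right ht (by positivity)
  have h3 : 0 ≤ ρ * t := mul_nonneg hρ.le ht0
  have e1 : -((4 * ρ + 5) * t + 2 / β) + t * (ρ + 2 + (1 + ρ + ((4 * ρ + 5) * t + 2 / β))) =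
      -(2 * (ρ * t)) - 2 * t - 2 / β + (4 * ρ + 5) * t * t + t * (2 / β) := by ring
  have e2 : -(3 / (2 * β)) = -(2 / β) + 1 / 4 * (2 / β) := by field_simp; ring
  rw [e1, e2]
  have h4 : (4 * ρ + 5) * t * (1 / 4) = ρ * t + 5 / 4 * t := by ring
  linarith [h1, h2, h3, h4, ht0]

end Summit.QuantumFields.YangMills.Theorems.VirialFluxGap.TauberMeanUpperPrep

end
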